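import Summits.CriticalPhenomena.PercolationContinuityZ3.Theses.PercNearOneGluing
import Literature.Probability.Percolation.PercolationProofs

/-!
# Sketch — helper-lemma STATEMENTS for `stub_goodStep` (stub-ideation k = 2, RESHAPE family)

Elaboration sanity only (`sorry` bodies).  Vocabulary = the skeleton
`Cruxes/AdditiveGluing/Lines/subuniform-dead-pocket-maximum.lean`; no imports of un-landed files.
The two local abbreviations `glueW`, `killW` are the explicit lambdas of the landed k24 files and are
meant to be inlined in a Theorems file.
-/

namespace Summit.CriticalPhenomena.PercolationContinuityZ3.Cruxes.AdditiveGluing.StubIdeasK2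

open MeasureTheory Literature.Probability.LatticeModels Literature.Probability.Percolation
open scoped Classical BigOperators

noncomputable section

variable {n : ℕ}

/-- the block `S` glued by weight-1 pairs (k24's lambda). -/
def glueW (u : Sym2 (Fin n) → unitInterval) (S : Finset (Fin n)) : Sym2 (Fin n) → unitInterval :=
  fun e => if (∀ x ∈ e, x ∈ S) ∧ ¬ e.IsDiag then 1 else u e

/-- the star of `x` killed (k24/k32's lambda `w⁰`). -/
def killW (u : Sym2 (Fin n) → unitInterval) (x : Fin n) : Sym2 (Fin n) → unitInterval :=
  fun e => if x ∈ e then 0 else u e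

/-- GOOD left side `L_w(sel)` of the registered stub (verbatim shape). -/
def goodL (w : Sym2 (Fin n) → unitInterval) (A : Finset (Fin n)) (o b : Fin n)
    (sel : Finset (Fin n) → Fin n) : ℝ :=
  (prodBernoulli w).real ((⋃ a ∈ A, openConn o a) ∩ (openConn o b)ᶜ)
    + ∑ W ∈ (Finset.univ : Finset (Finset (Fin n))).filter (fun W => o ∈ W ∧ Disjoint W A),
        (prodBernoulli w).real {ω : BondConfig (Fin n) | openCluster ω o = (W : Set (Fin n))}
          * (prodBernoulli w).real (openConnIn ((W : Set (Fin n))ᶜ) (sel W) b)ᶜ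

/-- **Block goodness in the UNGLUED graph** `BG_u(S; a₀, sel)`:
`μ_u(a₀↔b) + μ_u(a₀↮b, a₀↔S, S↔b) ≤ μ_u(S↔b) + Σ_{W' ∩ A = ∅} μ_u(K_S = W') · μ_u(sel W' ↔ b in W'ᶜ)`,
`K_S = ⋃_{s∈S} C(s)`.  For `u = K` (star of `o` killed) and `sel' = sel ∘ insert o` this is k24's kernel
GLUE-GOOD (`goodStep24_main`, hypothesis `hker`) with the glued two-point function expanded (P1a). -/
def BG (u : Sym2 (Fin n) → unitInterval) (A S : Finset (Fin n)) (b a₀ : Fin n)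
    (sel : Finset (Fin n) → Fin n) : Prop :=
  (prodBernoulli u).real (openConn a₀ b)
      + (prodBernoulli u).real ((openConn a₀ b)ᶜ ∩ (⋃ s ∈ S, openConn a₀ s) ∩ (⋃ s ∈ S, openConn s b))
    ≤ (prodBernoulli u).real (⋃ s ∈ S, openConn s b)
      + ∑ W' ∈ (Finset.univ : Finset (Finset (Fin n))).filter (fun W' => Disjoint W' A),
          (prodBernoulli u).real {ω : BondConfig (Fin n) | ∀ z : Fin n, (z ∈ W' ↔ ω ∈ ⋃ s ∈ S, openConn s z)}
            * (prodBernoulli u).real (openConnIn ((W' : Set (Fin n))ᶜ) (sel W') b)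

/-! ## PLAN 1 — block-goodness calculus (strengthen to observer BLOCKS + designated reference; peel one block vertex) -/

/-- P1a(i) **un-gluing the two-point function**: `τ_{u/S}(a₀) = τ_u(a₀) + μ_u(a₀↮b, a₀↔S, S↔b)`
(`stub_gluePushforward` + `glueReach`, landed). -/
theorem glue_real_openConn_eq (u : Sym2 (Fin n) → unitInterval) (S : Finset (Fin n)) (a₀ b : Fin n)
    (ha₀ : a₀ ∉ S) (hb : b ∉ S) :
    (prodBernoulli (glueW u S)).real (openConn a₀ b) =
      (prodBernoulli u).real (openConn a₀ b)
        + (prodBernoulli u).real ((openConn a₀ b)ᶜ ∩ (⋃ s ∈ S, openConn a₀ s) ∩ (⋃ s ∈ S, openConn s b)) := by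
  sorry

/-- P1a(ii)(iii) **reachability FROM the block is glue-invariant** (live term and block-cluster law). -/
theorem glue_real_block_eq (u : Sym2 (Fin n) → unitInterval) (S W' : Finset (Fin n)) (b : Fin n) :
    (prodBernoulli (glueW u S)).real (⋃ s ∈ S, openConn s b) = (prodBernoulli u).real (⋃ s ∈ S, openConn s b) ∧
    (prodBernoulli (glueW u S)).real
        {ω : BondConfig (Fin n) | ∀ z : Fin n, (z ∈ W' ↔ ω ∈ ⋃ s ∈ S, openConn s z)} =
      (prodBernoulli u).real
        {ω : BondConfig (Fin n) | ∀ z : Fin n, (z ∈ W' ↔ ω ∈ ⋃ s ∈ S, openConn s z)} := by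
  sorry

/-- P1b **peeling one block vertex** (exact σ-decomposition at `x ∈ S`, the k24 engine run at a block
vertex instead of `o`): if BG holds for the star-killed weighting `u^x` and every child block
`(S.erase x) ∪ S'` (`S'` a non-null layer of `x`), with the selection shifted by `insert x`, then BG
holds for `(u, S)`.  The four terms of BG decompose termwise over the layers of `x`; the `a₀`-side uses
`{a₀↔S' ∧ S'↔b} ⊆ {a₀↔S₁ ∧ S₁↔b}`.  Degenerate child `S₁ = ∅` reads `τ_{u^x}(a₀) ≤ τ_{u^x}(sel {x})`. -/
theorem blockGood_peel (u : Sym2 (Fin n) → unitInterval) (A S : Finset (Fin n)) (b a₀ x : Fin n)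
    (hx : x ∈ S) (hSA : Disjoint S A) (hbA : b ∈ A) (ha₀A : a₀ ∈ A) (sel : Finset (Fin n) → Fin n)
    (hsel : ∀ W, sel W ∈ A)
    (hlayers : ∀ S' : Finset (Fin n), x ∉ S' →
      (prodBernoulli u).real {ω : BondConfig (Fin n) | ∀ y : Fin n, y ≠ x → (s(x, y) ∈ ω ↔ y ∈ S')} ≠ 0 →
      BG (killW u x) A (S.erase x ∪ S') b a₀ (fun W'' => sel (insert x W''))) :
    BG u A S b a₀ sel := by
  sorry

/-- P1c(i) **Lemma-5 leaf**: a block containing a vertex at least as `u`-reliable as `a₀` is good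
for `a₀` (KN Lemma 5, block form = landed `stub_gluingLemma5`, plus P1a and nonnegativity of the pocket sum). -/
theorem blockGood_leaf_lemma5 (u : Sym2 (Fin n) → unitInterval) (A S : Finset (Fin n)) (b a₀ v : Fin n)
    (sel : Finset (Fin n) → Fin n) (hv : v ∈ S) (hbS : b ∉ S) (ha₀S : a₀ ∉ S)
    (hle : (prodBernoulli u).real (openConn a₀ b) ≤ (prodBernoulli u).real (openConn v b)) :
    BG u A S b a₀ sel := by
  sorry

/-- P1c(ii) **IH leaf**: if `a₀` is a minimiser of the GLUED two-point function over `A`, goodness of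
the glued quadruple `(u/S, A, s₀, b)` (the skeleton's induction hypothesis, realised as in
`goodStep24_card_lt`) at its tightest level gives BG (k13's `goodStepK13_designated_of_good` for a
block observer; pockets `{C(s₀) = W}` under `u/S` are `{K_S = W}`, and the selection factor does not
see the glue pairs inside `W ⊇ S`). -/
theorem blockGood_leaf_ih (u : Sym2 (Fin n) → unitInterval) (A S : Finset (Fin n)) (b a₀ s₀ : Fin n)
    (sel : Finset (Fin n) → Fin n) (hs₀ : s₀ ∈ S) (hSA : Disjoint S A) (hbA : b ∈ A) (ha₀A : a₀ ∈ A)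
    (hsel : ∀ W, sel W ∈ A)
    (hmin : ∀ a ∈ A, (prodBernoulli (glueW u S)).real (openConn a₀ b) ≤
      (prodBernoulli (glueW u S)).real (openConn a b))
    (hgood : ∀ (t : ℝ) (sel₁ : Finset (Fin n) → Fin n), (∀ W, sel₁ W ∈ A) →
      (∀ a ∈ A, 1 - t ≤ (prodBernoulli (glueW u S)).real (openConn a b)) →
      goodL (glueW u S) A s₀ b sel₁ ≤ t) :
    BG u A S b a₀ sel := by
  sorry

/-! ## PLAN 2 — relay-routed goodness `(★★)` = GOOD with the observer's relay-free routes to `b` discarded -/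

/-- P2a **reduction** (bookkeeping, pocket Markov `goodBridge_real_clusterIs_inter_openConn`):
`(★★)` at any `a₁ ∈ A` for every selection ⟹ the registered selection form, with `Y₂ = μ(o↔b, o↮A∖b)` to spare. -/
theorem good_of_relayRouted (w : Sym2 (Fin n) → unitInterval) (A : Finset (Fin n)) (o b a₁ : Fin n)
    (hbA : b ∈ A) (hoA : o ∉ A) (ha₁A : a₁ ∈ A)
    (hRR : ∀ sel : Finset (Fin n) → Fin n, (∀ W, sel W ∈ A) →
      (prodBernoulli w).real (openConn a₁ b) ≤
        (prodBernoulli w).real (openConn o b ∩ ⋃ a ∈ A.erase b, openConn o a)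
          + ∑ W ∈ (Finset.univ : Finset (Finset (Fin n))).filter (fun W => o ∈ W ∧ Disjoint W A),
              (prodBernoulli w).real
                ({ω : BondConfig (Fin n) | openCluster ω o = (W : Set (Fin n))} ∩ openConn (sel W) b)) :
    ∀ (t : ℝ) (sel : Finset (Fin n) → Fin n), (∀ W, sel W ∈ A) →
      (∀ a ∈ A, 1 - t ≤ (prodBernoulli w).real (openConn a b)) → goodL w A o b sel ≤ t := by
  sorry

/-- P2b **KERNEL (★★), conjectural for `|A∖b| ≥ 3`** (for `|A∖b| ≤ 2` it is exactly the landed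
`PocketBHK.c1_event` / `stub_goodCardLeThree_k42` after P2a's bookkeeping): some relay — any
`τ`-minimiser — is dominated by "`o` reaches `b` AND a relay" plus the selected-relay pocket credit. -/
def RelayRoutedGood : Prop :=
  ∀ (n : ℕ) (w : Sym2 (Fin n) → unitInterval) (A : Finset (Fin n)) (o b : Fin n), b ∈ A → o ∉ A →
    ∃ a₁ ∈ A, ∀ sel : Finset (Fin n) → Fin n, (∀ W, sel W ∈ A) →
      (prodBernoulli w).real (openConn a₁ b) ≤
        (prodBernoulli w).real (openConn o b ∩ ⋃ a ∈ A.erase b, openConn o a)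
          + ∑ W ∈ (Finset.univ : Finset (Finset (Fin n))).filter (fun W => o ∈ W ∧ Disjoint W A),
              (prodBernoulli w).real
                ({ω : BondConfig (Fin n) | openCluster ω o = (W : Set (Fin n))} ∩ openConn (sel W) b)

/-! ## PLAN 3 — one-bond interpolation at an ARBITRARY pair (induction on the number of fractional pairs) -/

/-- P3a **`L_w(sel)` is affine in the weight of ANY pair `e`** (generalises k8 `goodStep_lhs_affine` /
k15 `goodStepEI_L_decomp` from pairs at `o` to all pairs: for `W ∋ o`, `μ(C(o)=W)` is determined by the
pairs meeting `W` and `μ(sel W ↔ b in Wᶜ)` by the pairs inside `Wᶜ`, so for each `e` one factor is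
constant; `stub_oneBondDecomp_k15` does the rest). -/
theorem goodL_affine_pair (w : Sym2 (Fin n) → unitInterval) (A : Finset (Fin n)) (o b : Fin n)
    (e : Sym2 (Fin n)) (sel : Finset (Fin n) → Fin n) :
    goodL w A o b sel = (1 - (w e : ℝ)) * goodL (Function.update w e 0) A o b sel
      + (w e : ℝ) * goodL (Function.update w e 1) A o b sel := by
  sorry

/-- P3b **deterministic base**: with all weights in `{0,1}` every quadruple is good. -/
theorem good_of_zeroOne (w : Sym2 (Fin n) → unitInterval) (hw : ∀ e, w e = 0 ∨ w e = 1)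
    (A : Finset (Fin n)) (o b : Fin n) (hbA : b ∈ A) :
    ∀ (t : ℝ) (sel : Finset (Fin n) → Fin n), (∀ W, sel W ∈ A) →
      (∀ a ∈ A, 1 - t ≤ (prodBernoulli w).real (openConn a b)) → goodL w A o b sel ≤ t := by
  sorry

/-- P3c **interpolation at any pair with a common reference** (verbatim `goodStepEI_interpolate`, any `e`). -/
theorem good_interpolate_pair (w : Sym2 (Fin n) → unitInterval) (A : Finset (Fin n)) (o b a : Fin n)
    (e : Sym2 (Fin n)) (sel : Finset (Fin n) → Fin n)
    (h0 : goodL (Function.update w e 0) A o b sel ≤ (prodBernoulli (Function.update w e 0)).real (openConn a b)ᶜ)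
    (h1 : goodL (Function.update w e 1) A o b sel ≤ (prodBernoulli (Function.update w e 1)).real (openConn a b)ᶜ) :
    goodL w A o b sel ≤ (prodBernoulli w).real (openConn a b)ᶜ := by
  sorry

/-- P3d **KERNEL K3⁺, conjectural**: some fractional pair admits a DESIGNATED TRANSFER in one of the two
directions (the minimiser at one endpoint is admissible at the other).  k8's `GlueStep` / k15's `hR4`
are the instances `e = s(o,y)`, direction delete→glue; K3⁺ only asks for SOME pair and SOME direction. -/
def ExistsTransferPair : Prop :=
  ∀ (n : ℕ) (w : Sym2 (Fin n) → unitInterval) (A : Finset (Fin n)) (o b : Fin n), b ∈ A → o ∉ A →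
    (∃ e, 0 < (w e : ℝ) ∧ (w e : ℝ) < 1) →
    ∃ (e : Sym2 (Fin n)) (a : Fin n) (c : unitInterval), 0 < (w e : ℝ) ∧ (w e : ℝ) < 1 ∧ a ∈ A ∧
      (c = 0 ∨ c = 1) ∧
      (∀ a' ∈ A, (prodBernoulli (Function.update w e c)).real (openConn a b) ≤
        (prodBernoulli (Function.update w e c)).real (openConn a' b)) ∧
      ∀ sel : Finset (Fin n) → Fin n, (∀ W, sel W ∈ A) →
        goodL (Function.update w e (unitInterval.symm c)) A o b sel ≤
          (prodBernoulli (Function.update w e (unitInterval.symm c))).real (openConn a b)ᶜ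

end

end Summit.CriticalPhenomena.PercolationContinuityZ3.Cruxes.AdditiveGluing.StubIdeasK2
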